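import Literature.NumberTheory.EllipticCurves.QuadraticTwistKroneckerLFunctionProofs
import Summits.BirchSwinnertonDyer.Rank1Residual.AdditivePotMult.QuadraticTwistRamifiedMultiplicative
import HarnessLib

/-!
# `aₙ(E^{(D)}) = (n / |D|)·aₙ(E)` for an odd fundamental discriminant `D` when the twist is ADDITIVE at the
# primes dividing `D` — in particular for `E` good OR multiplicative there (cell `b2b-bsdres`, seat
# additive-p4 GEN 22, line V41 "minimal-twist reach"; input of `Additive/QuadraticTwistNewform.lean`)

HONEST FRAMING (cell `b2b-bsdres`, run/shared/lean/b2b/bsd-rank1-residual/, verbatim in every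
file): the goal of the cell is to DELETE the COMBINATION-SHAPED residual classes of the
Birch–Swinnerton-Dyer formula for ALL analytic-rank `≤ 1` elliptic curves over `ℚ` — "full BSD
formula for every rank `≤ 1` curve in class `C`" assembled STRICTLY from published theorems — so
that the rank-`≤ 1` remainder becomes exactly the CONSTRUCTION-SHAPED classes, which are TYPED
(missing-input `Prop`s), NOT attempted. This is not "finishing BSD". Seat additive-p4 (X3♯/X4♯
direct): research route on the CONSTRUCTION-SHAPED class X4; no claim beyond the stated classes;
labels / marks UNCHANGED; NOTHING here is booked. THEOREMS ONLY (no definition, no Literature fact).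

The tree's `WeierstrassCurve.LFunction_quadraticTwist_apply_of_isGloballyMinimal`
(`Literature/NumberTheory/EllipticCurves/QuadraticTwistKroneckerLFunctionProofs.lean`) proves the
coefficient identity `aₙ(E^{(D)}) = (n/|D|)·aₙ(E)` for ALL `n` when `E` has GOOD reduction at the
primes dividing `D`; good reduction is used only to know that the twist is ADDITIVE there. Here the
hypothesis is that additivity itself (`lFunction_quadraticTwist_apply_of_hasAdditiveReductionAt`,
proof otherwise verbatim), with the corollary for `E` good OR MULTIPLICATIVE at those primes
(`…_of_good_or_mult`, via the cell's `AdditivePotMult.hasAdditiveReductionAt_quadraticTwist_of_dvd_of_mult`)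
— the case of the conductor-minimal quadratic twist `W₀` of an X4 curve `W` of the (M) cell
(`p ∣ D`, `W₀` multiplicative at `p`; 295 of the 554 LOWER rows of this seat's census, kit j135748).

References: Silverman AEC X.2, Exercise 10.16, VII.5 Prop. 5.1 [SilvermanAEC2009]; Cox §1.C Lemma 1.14
[Cox2013] (the Kronecker symbol `(D/·) = (·/|D|)`).
-/

noncomputable section

open scoped Classical MatrixGroups ModularForm NumberTheorySymbols
open CongruenceSubgroup WeierstrassCurve Literature.NumberTheory.EllipticCurves
  Literature.NumberTheory.EllipticCurves.ModularForms Literature.NumberTheory.QuadraticFields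
  IsDedekindDomain NumberField

namespace Summit.BirchSwinnertonDyer.Rank1Residual.Additive

/-! ## §1 `aₙ(W₀^{(D)}) = (n / |D|) aₙ(W₀)` when the twist is additive at the primes dividing `D` -/

section Coefficients

variable (W : WeierstrassCurve ℚ) [W.IsElliptic]

/-- **`aₙ(E^{(D)}) = (n / |D|)·aₙ(E)` for all `n`**, for `D ≡ 1 (mod 4)` square-free and the twist
`E^{(D)}` ADDITIVE at every place over a prime dividing `D` (`E` a global minimal model). The tree's
`LFunction_quadraticTwist_apply_of_isGloballyMinimal` assumes `E` GOOD at those primes and uses it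
only to get this additivity (`hasAdditiveReductionAt_quadraticTwist_of_dvd`); the Euler-product
comparison is otherwise verbatim: at a ramified place the twist's factor is `1` and `χ_D(ℓ) = 0`, at
an unramified place the factor is the `χ_D(ℓ)`-rescaling (`localEulerFactor_quadraticTwist_*`).
[cite: SilvermanAEC2009, X.2 and Exercise 10.16] -/
theorem lFunction_quadraticTwist_apply_of_hasAdditiveReductionAt [W.IsGloballyMinimal] {D : ℤ}
    (hD4 : D % 4 = 1) (hsq : Squarefree D)
    (hadd : ∀ v : HeightOneSpectrum (𝓞 ℚ), ((Rat.HeightOneSpectrum.primesEquiv v : ℕ) : ℤ) ∣ D →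
      (W.quadraticTwist (D : ℚ)).HasAdditiveReductionAt v)
    (n : ℕ) :
    (W.quadraticTwist (D : ℚ)).LFunction n = J((n : ℤ) | D.natAbs) * W.LFunction n := by
  open Rat.HeightOneSpectrum IsDedekindDomain.HeightOneSpectrum in
  have hD0 : D ≠ 0 := by rintro rfl; norm_num at hD4
  have hDq : (D : ℚ) ≠ 0 := by exact_mod_cast hD0
  haveI : (W.quadraticTwist (D : ℚ)).IsElliptic := W.isElliptic_quadraticTwist hDq
  rw [LFunction_eq_eulerProduct, LFunction_eq_eulerProduct]
  refine ArithmeticFunction.eulerProduct_apply_eq_mul_of_forall (P := fun _ ↦ True)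
    (fun _ _ _ ↦ ⟨trivial, trivial⟩) (fun n : ℕ ↦ J((n : ℤ) | D.natAbs))
    (by exact_mod_cast jacobiSym.one_left D.natAbs)
    (fun m n ↦ by push_cast; exact jacobiSym.mul_left _ _ _) _ _ (fun v m _ ↦ ?_)
    (eventually_cofinite_localEulerFactor_apply _) (eventually_cofinite_localEulerFactor_apply _) trivial
  haveI := Fact.mk (primesEquiv v).2
  have hℓ1 : 1 < (primesEquiv v : ℕ) := (primesEquiv v).2.one_lt
  by_cases hvD : ((primesEquiv v : ℕ) : ℤ) ∣ D
  · -- ramified place: the factor of the twist is trivial and `χ_D(ℓ) = 0`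
    have hadd' := hadd v hvD
    haveI : NeZero D.natAbs := ⟨Int.natAbs_ne_zero.mpr hD0⟩
    have hJ0 : J(((primesEquiv v : ℕ) : ℤ) | D.natAbs) = 0 := by
      rw [jacobiSym.eq_zero_iff_not_coprime, Int.gcd_natCast_natCast]
      intro hcop
      have hdvd : (primesEquiv v : ℕ) ∣ D.natAbs := Int.natCast_dvd.mp hvD
      exact (primesEquiv v).2.one_lt.ne' (Nat.Coprime.eq_one_of_dvd hcop hdvd)
    rw [localEulerFactor_eq_one_of_hasAdditiveReduction _ hadd', ArithmeticFunction.one_apply]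
    split_ifs with hm1
    · rw [hm1, localEulerFactor_apply_one, Nat.cast_one, jacobiSym.one_left, one_mul]
    · by_cases hpow : ∃ k, Nat.card (IsLocalRing.ResidueField (v.adicCompletionIntegers ℚ)) ^ k = m
      · obtain ⟨k, rfl⟩ := hpow
        rw [natCard_residueField_adicCompletionIntegers] at hm1 ⊢
        have hk : k ≠ 0 := fun h ↦ hm1 (by rw [h, pow_zero])
        rw [Nat.cast_pow, jacobiSym.pow_left, hJ0, zero_pow hk, zero_mul]
      · rw [localEulerFactor_apply_eq_zero _ _ (by rwa [natCard_residueField_adicCompletionIntegers]) hpow,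
          mul_zero]
  · -- unramified place
    have key : ((W.quadraticTwist (D : ℚ)).baseChange (v.adicCompletion ℚ)).localEulerFactor
        (v.adicCompletionIntegers ℚ) =
        ArithmeticFunction.ofPowerSeries (primesEquiv v : ℕ)
          (PowerSeries.rescale (J(((primesEquiv v : ℕ) : ℤ) | D.natAbs))
            ((W.baseChange (v.adicCompletion ℚ)).localPowerSeries (v.adicCompletionIntegers ℚ))) := by
      by_cases hv2 : (primesEquiv v : ℕ) = 2
      · exact W.localEulerFactor_quadraticTwist_two_of_emod_four_eq_one hD4 v hv2
      · exact W.localEulerFactor_quadraticTwist_of_odd_of_not_dvd hD4 v hv2 hvD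
    rw [key, localEulerFactor, natCard_residueField_adicCompletionIntegers]
    exact ArithmeticFunction.ofPowerSeries_rescale_apply hℓ1 (fun n : ℕ ↦ J((n : ℤ) | D.natAbs))
      (by exact_mod_cast jacobiSym.one_left D.natAbs)
      (fun m n ↦ by push_cast; exact jacobiSym.mul_left _ _ _) _ m

/-- **`aₙ(E^{(D)}) = (n / |D|)·aₙ(E)` for all `n`, `E` good OR MULTIPLICATIVE at the primes dividing
`D`** (`D ≡ 1 (mod 4)` square-free, `E` a global minimal model): in both cases the twist is additive
there (`hasAdditiveReductionAt_quadraticTwist_of_dvd`, and the cell's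
`AdditivePotMult.hasAdditiveReductionAt_quadraticTwist_of_dvd_of_mult`). The case met by the
conductor-minimal twist of an X4 curve of the (M) cell (`p ∣ D`, `W₀` multiplicative at `p`).
[cite: SilvermanAEC2009, X.2 and VII.5 Prop. 5.1] -/
theorem lFunction_quadraticTwist_apply_of_good_or_mult [W.IsGloballyMinimal] {D : ℤ}
    (hD4 : D % 4 = 1) (hsq : Squarefree D)
    (hgm : ∀ v : HeightOneSpectrum (𝓞 ℚ), ((Rat.HeightOneSpectrum.primesEquiv v : ℕ) : ℤ) ∣ D →
      W.HasGoodReductionAt v ∨ W.HasMultiplicativeReductionAt v)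
    (n : ℕ) :
    (W.quadraticTwist (D : ℚ)).LFunction n = J((n : ℤ) | D.natAbs) * W.LFunction n := by
  open Rat.HeightOneSpectrum in
  refine lFunction_quadraticTwist_apply_of_hasAdditiveReductionAt W hD4 hsq (fun v hvD ↦ ?_) n
  have hD0 : D ≠ 0 := by rintro rfl; norm_num at hD4
  have hv2 : (primesEquiv v : ℕ) ≠ 2 := by
    intro h
    rw [h] at hvD
    have : D % 2 = 0 := Int.emod_eq_zero_of_dvd (by exact_mod_cast hvD)
    omega
  have hsq' : ¬ ((primesEquiv v : ℕ) : ℤ) ^ 2 ∣ D := by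
    intro h
    have hu := hsq ((primesEquiv v : ℕ) : ℤ) (by rw [← sq]; exact h)
    rw [Int.isUnit_iff_natAbs_eq, Int.natAbs_natCast] at hu
    exact (primesEquiv v).2.one_lt.ne' hu
  rcases hgm v hvD with hg | hm
  · exact W.hasAdditiveReductionAt_quadraticTwist_of_dvd v hv2 hD0 hvD hsq' hg
  · exact (AdditivePotMult.hasAdditiveReductionAt_quadraticTwist_of_dvd_of_mult W v hv2 hvD hsq' hm).2.1

end Coefficients


end Summit.BirchSwinnertonDyer.Rank1Residual.Additive

end
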